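import Literature.NumberTheory.Rogawski1990.LocalNormFibreBoundedReps     -- ★-to-be FILE B (this seat): REP-H `exists_isCompact_normFibre_reps`; brings ★ `LocalNormFibreNonsplit` (norm fibre ≤ 3)
import Literature.NumberTheory.Rogawski1990.Ch12Sec5Defs                   -- ★ TR dictionary: `EllipticData` (`up`, `DG`, `DH`, `regG`, `regH`, `stConjH`), `IsStableClassFunOn`
import HarnessLib

/-!
# F0 · P3c · line LH6 «StCharTS» — datum-road slice S13c «UP-DOM ⟸ UP-DEF★»: Lemma 12.5.1's class function `α^G`, DEFINED in transfer-factor form,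
# is dominated on every compact set by at most three values of `D_H·α` on a compact subset of `H_v`
# [Rogawski1990, §12.5 Lemma 12.5.1 p. 183; §5.4 p. 78; §4.9 p. 55]

Cell `pub/hodgecm-mathlib`, crux H413 = `stmt-HodgeConjecture-24833` (lane `--kind proof --supports … --as helper`), route HCCMUnconditional; seat LH4-p01 (g5);
DEAL: datum-road map owner LH6-p01 (g4) SLICE WORDS (2) 11:49:03Z (S13-CENSUS) + 11:59:07Z ((1) shape (B) «transfer-factor form» for the `up` field, (2) S13c to
this seat); census memo `F0/P3c/LH4/LH4-p01/g5/S13-CENSUS.v1.LH4p01g5.md` 1386216c; consumer S13a «U2∕HCB-UP-OF-UPDOM★» (F0P3-p02 (g20)) takes this file's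
CONCLUSION (UP-DOM) as its hypothesis `hUpDom` with `P := IsLocalGRegular L v`, `n := 3`.  THEOREMS ONLY (no definition, no instance, no notation, no named
fact, no `sorry`); ★-only imports.  FILE C of three (A = ★ `LocalUnitaryRankTwoHilbertSection`, B = ★ `LocalNormFibreBoundedReps`).
HONEST LABEL: HC_CM is proved only modulo the 7 printed citations (2 remaining: hLiu418 = `stmt-HodgeConjecture-24832`, h413 = `stmt-HodgeConjecture-24833`)
until rung 0 closes; count-neutral — at the future concrete datum the sockets (U2) `L2UpOnTorus` and (HCB-up) of the (S-𝔇) organ `stub_EllipticPackage`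
(`Cruxes/H413/Lines/F0_P3c_StCharTSPaydown.lean` ED. 17) become theorems through S13a + this file once the constructor DEFINES `up` by (UP-DEF); `UpSpec`
and `Prop1252` stay NAMED [§12.5 p. 183, Prop. 12.5.2 p. 184] — honestly so, since (UP-DEF) IS print's `α^G`.

THE MATHEMATICS.  `G = U(Φ₃)(L⁺_v)` (`v` non-split), `H = U(Φ₂) × U(Φ₁)`, `𝔇` a §12.5 datum (★ `Ch12Sec5.EllipticData G H`).  (UP-DEF) = Lemma 12.5.1 read
class by class in the tree's transfer-factor vocabulary: for `x ∈ G^{reg}`,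
  `α^G(x) = D_G(x)⁻¹ · Σ_s τ_v(s) · D_H(s) · κ_v(s, x) · α(s)`,
the sum over the `H`-STABLE classes `s` of `G`-regular elements matched to `x` (★ `IsLocalNormPair`; `τ_v` = ★ `finTau`, `κ_v` = ★ `finKappaAt ∈ {0, ±1}`; a
`finsum` over `Quot (IsLocalStablyConjH L v)` with `Quot.out` representatives — legitimate because every factor is a stable-class function, ★
`FinExplicitTransferFactorStableInvariance`), and `α^G = 0` off `G^{reg}`.  Print's `Σ_{w ∈ Ω_F(T,H)∖Ω_F(T,G)} τ(wγw⁻¹) D_H(wγw⁻¹) κ(w(δ)) α(wγw⁻¹)` is this sum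
(`w ↦ s = [wγw⁻¹]_st` is a bijection onto the matched `H`-stable classes, `κ(w(δ)) = κ_v(wγw⁻¹, γ^δ)`).  (UP-DOM): for a STABLE class function `α` on `H^r`
and every compact `K ⊆ G` there is a compact `C ⊆ H` such that for `x ∈ K`: `α^G(x) = 0` if `x ∉ G^{reg}`, and otherwise there are `≤ 3` `G`-regular `s_i ∈ C` with
`‖D_G(x)·α^G(x)‖ ≤ Σ_i ‖D_H(s_i)·α(s_i)‖`.  PROOF: the support of the `finsum` injects into the NORM FIBRE of `x`, which has `≤ 3` stable classes (★
`exists_finset_normFibre_card_le_three`, §5.4 p. 78); `‖τ_v‖ ≤ 1` (`μ` unitary: ★ `finHeckeValue` is a value of `μ` or `0`), `‖κ_v‖ ≤ 1`; `D_G·(D_G⁻¹·Σ) = Σ` or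
`0`; and each fibre class has a `G`-regular representative in the compact `C` of ★ REP-H `exists_isCompact_normFibre_reps` (FILE B), to which `α` (stable on
`H^r ⊇` the `G`-regular set, hyps `hStH`, `hRegH`) and `D_H` (hyp `hDHst`) transport.
* §1 `norm_finTau_le_one`, `norm_finKappaAt_le_one`;  §2 HEAD `upDom_of_upDef`.

## References
* [Rogawski1990] J. D. Rogawski, *Automorphic Representations of Unitary Groups in Three Variables*, Ann. of Math. Stud. 123 (1990): §12.5 Lemma 12.5.1 p. 183 (`α^G`);
  §5.4 p. 78 (three stable classes of `H` over a class of type `(E¹)³`); §4.9 p. 55 (`τ`, `D_{G∕H}`, `Δ_{G∕H}`); §12.7 Lemma 12.7.2 (proof) p. 193 («`χ_ρ^G` has bounded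
  elliptic norm»).
-/

set_option autoImplicit false
set_option linter.dupNamespace false

noncomputable section

open NumberField IsDedekindDomain MeasureTheory Filter Topology
open scoped Matrix MatrixGroups Classical
open Literature.NumberTheory.Rogawski1990 Literature.NumberTheory.Automorphic Literature.NumberTheory.Automorphic.UnitaryGroup
open Literature.NumberTheory.GaloisRepresentations

namespace Summit.HodgeConjecture.HodgeConjecture.Cruxes.H413.F0P3cStCharTSUpDom

variable (L : Type) [Field L] [NumberField L] [IsCMField L] (v : HeightOneSpectrum (𝓞 ↥(maximalRealSubfield L)))

/-! ## §1 `‖τ_v‖ ≤ 1` and `‖κ_v‖ ≤ 1` -/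

/-- **`‖τ_v(γ_H)‖ ≤ 1` for a unitary `μ`**: `τ_v = μ_v(γ₂)·μ_v(…)⁻¹` with ★ `finHeckeValue` a value of the unitary `μ` (norm `1`) or `0` at non-units.
[cite: Rogawski1990, §4.9 p. 55] -/
theorem norm_finTau_le_one (μ : HeckeCharacter L) (hμ : μ.IsUnitary)
    (a : (UnitaryGroup.cmDatum L 2 (Matrix.of fun i j : Fin 2 => if i.val + j.val + 1 = 2 then (1 : L) else 0)).Local v ×
      (UnitaryGroup.cmDatum L 1 (Matrix.of fun i j : Fin 1 => if i.val + j.val + 1 = 1 then (1 : L) else 0)).Local v) :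
    ‖finTau L v a μ‖ ≤ 1 := by
  have hval : ∀ x : UnitaryGroup.LocalRing L v, ‖finHeckeValue L v μ x‖ ≤ 1 := by
    intro x
    by_cases hx : IsUnit x
    · rw [finHeckeValue_of_isUnit L v μ hx, semilocalComponent_apply, hμ]
    · rw [finHeckeValue_of_not_isUnit L v μ hx, norm_zero]
      exact zero_le_one
  have hinv : ∀ x : UnitaryGroup.LocalRing L v, ‖(finHeckeValue L v μ x)⁻¹‖ ≤ 1 := by
    intro x
    by_cases hx : IsUnit x
    · rw [norm_inv, finHeckeValue_of_isUnit L v μ hx, semilocalComponent_apply, hμ, inv_one]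
    · rw [finHeckeValue_of_not_isUnit L v μ hx, inv_zero, norm_zero]
      exact zero_le_one
  unfold finTau
  rw [norm_mul]
  calc ‖finHeckeValue L v μ (finGammaTwo L v a)‖ * ‖(finHeckeValue L v μ (finTauArg L v a))⁻¹‖
      ≤ 1 * 1 := mul_le_mul (hval _) (hinv _) (norm_nonneg _) zero_le_one
    _ = 1 := mul_one 1

/-- **`‖κ_v(γ_H, γ′)‖ ≤ 1`**: ★ `finKappaAt ∈ {0, ±1}` by its definition. [cite: Rogawski1990, §4.3 p. 43; §14.6 p. 242] -/
theorem norm_finKappaAt_le_one (H' : Matrix (Fin 3) (Fin 3) L)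
    (a : (UnitaryGroup.cmDatum L 2 (Matrix.of fun i j : Fin 2 => if i.val + j.val + 1 = 2 then (1 : L) else 0)).Local v ×
      (UnitaryGroup.cmDatum L 1 (Matrix.of fun i j : Fin 1 => if i.val + j.val + 1 = 1 then (1 : L) else 0)).Local v)
    (γ' : (UnitaryGroup.cmDatum L 3 H').Local v) :
    ‖((finKappaAt L v H' a γ' : ℤ) : ℂ)‖ ≤ 1 := by
  unfold finKappaAt
  split_ifs <;> simp

/-! ## §2 (UP-DOM) ⟸ (UP-DEF) -/

/-- **S13c «UP-DOM ⟸ UP-DEF».**  Let `𝔇` be a §12.5 datum on `G = U(Φ₃)(L⁺_v)` (`v` non-split) and `H_v = U(Φ₂) × U(Φ₁)` with COMPAT `hreg` (`regG` = the regular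
semisimple set), the field facts `hStH` (`stConjH` = the tree's stable conjugacy on `H_v`), `hRegH` (`regH ⊇` the `G`-regular set), `hDHst` (`D_H` constant on
`G`-regular `H`-stable classes) and the FIELD EQUATION (UP-DEF) for `up` (Lemma 12.5.1 in transfer-factor form, `μ` unitary).  Then (UP-DOM): for every STABLE
class function `α` on `regH` and every compact `K ⊆ G` there is a compact `C ⊆ H_v` such that for `x ∈ K`: `up α x = 0` off `regG`, and on `regG` there is
`S ⊆ C` with `#S ≤ 3`, every member `G`-regular, and `‖D_G(x)·up α x‖ ≤ Σ_{s ∈ S} ‖D_H(s)·α(s)‖` — the text S13a «U2∕HCB-UP-OF-UPDOM★» consumes with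
`P := IsLocalGRegular L v`, `n := 3`. [cite: Rogawski1990, §12.5 Lemma 12.5.1 p. 183; §5.4 p. 78; §12.7 Lemma 12.7.2 (proof) p. 193] -/
theorem upDom_of_upDef (μ : HeckeCharacter L) (hμ : μ.IsUnitary)
    (hns : ∀ w : UnitaryGroup.PlacesOver L v, IsCMField.complexConj L • w.1 = w.1)
    [MeasurableSpace (Gqs L v)] [∀ γ : Gqs L v, MeasurableSpace (Gqs L v ⧸ Subgroup.centralizer ({γ} : Set (Gqs L v)))]
    [MeasurableSpace (Gqs L v ⧸ Subgroup.center (Gqs L v))]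
    [MeasurableSpace ((UnitaryGroup.cmDatum L 2 (Matrix.of fun i j : Fin 2 => if i.val + j.val + 1 = 2 then (1 : L) else 0)).Local v ×
      (UnitaryGroup.cmDatum L 1 (Matrix.of fun i j : Fin 1 => if i.val + j.val + 1 = 1 then (1 : L) else 0)).Local v)]
    (𝔇 : Ch12Sec5.EllipticData (Gqs L v)
      ((UnitaryGroup.cmDatum L 2 (Matrix.of fun i j : Fin 2 => if i.val + j.val + 1 = 2 then (1 : L) else 0)).Local v ×
        (UnitaryGroup.cmDatum L 1 (Matrix.of fun i j : Fin 1 => if i.val + j.val + 1 = 1 then (1 : L) else 0)).Local v))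
    (hreg : ∀ γ : Gqs L v, γ ∈ 𝔇.regG ↔ IsRegularElt (γ.val : GL (Fin 3) (UnitaryGroup.LocalRing L v)))
    (hStH : ∀ a b, 𝔇.stConjH a b ↔ IsLocalStablyConjH L v a b)
    (hRegH : ∀ a, IsLocalGRegular L v a → a ∈ 𝔇.regH)
    (hDHst : ∀ a b, IsLocalGRegular L v a → IsLocalStablyConjH L v a b → 𝔇.DH b = 𝔇.DH a)
    (hUp : ∀ (α : ((UnitaryGroup.cmDatum L 2 (Matrix.of fun i j : Fin 2 => if i.val + j.val + 1 = 2 then (1 : L) else 0)).Local v ×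
        (UnitaryGroup.cmDatum L 1 (Matrix.of fun i j : Fin 1 => if i.val + j.val + 1 = 1 then (1 : L) else 0)).Local v) → ℂ) (x : Gqs L v),
      𝔇.up α x =
        if IsRegularElt (x.val : GL (Fin 3) (UnitaryGroup.LocalRing L v)) then
          ((𝔇.DG x : ℂ))⁻¹ *
            ∑ᶠ q : Quot (IsLocalStablyConjH L v),
              (if IsLocalGRegular L v q.out ∧ IsLocalNormPair L (qsForm L) v q.out x then
                finTau L v q.out μ * (𝔇.DH q.out : ℂ) * ((finKappaAt L v (qsForm L) q.out x : ℤ) : ℂ) * α q.out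
              else 0)
        else 0) :
    ∀ α : ((UnitaryGroup.cmDatum L 2 (Matrix.of fun i j : Fin 2 => if i.val + j.val + 1 = 2 then (1 : L) else 0)).Local v ×
        (UnitaryGroup.cmDatum L 1 (Matrix.of fun i j : Fin 1 => if i.val + j.val + 1 = 1 then (1 : L) else 0)).Local v) → ℂ,
      Ch12Sec5.IsStableClassFunOn 𝔇.stConjH 𝔇.regH α →
      ∀ K : Set (Gqs L v), IsCompact K →
        ∃ C : Set ((UnitaryGroup.cmDatum L 2 (Matrix.of fun i j : Fin 2 => if i.val + j.val + 1 = 2 then (1 : L) else 0)).Local v ×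
            (UnitaryGroup.cmDatum L 1 (Matrix.of fun i j : Fin 1 => if i.val + j.val + 1 = 1 then (1 : L) else 0)).Local v),
          IsCompact C ∧
          ∀ x ∈ K, (x ∉ 𝔇.regG → 𝔇.up α x = 0) ∧
            (x ∈ 𝔇.regG →
              ∃ S : Finset ((UnitaryGroup.cmDatum L 2 (Matrix.of fun i j : Fin 2 => if i.val + j.val + 1 = 2 then (1 : L) else 0)).Local v ×
                  (UnitaryGroup.cmDatum L 1 (Matrix.of fun i j : Fin 1 => if i.val + j.val + 1 = 1 then (1 : L) else 0)).Local v),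
                S.card ≤ 3 ∧ (↑S : Set _) ⊆ C ∧ (∀ s ∈ S, IsLocalGRegular L v s) ∧
                  ‖(𝔇.DG x : ℂ) * 𝔇.up α x‖ ≤ ∑ s ∈ S, ‖(𝔇.DH s : ℂ) * α s‖) := by
  haveI : Algebra.IsQuadraticExtension ↥(maximalRealSubfield L) L := IsCMField.isQuadraticExtension L
  obtain ⟨w₀⟩ := UnitaryGroup.PlacesOver.nonempty L v
  have hsub : Subsingleton (UnitaryGroup.PlacesOver L v) :=
    PlacesOver.subsingleton_of_smul_eq (IsCMField.complexConj L) (IsCMField.complexConj_ne_one L) w₀ (hns w₀)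
  intro α hα K hK
  obtain ⟨C, hC, hrep⟩ := exists_isCompact_normFibre_reps hns K hK
  refine ⟨C, hC, fun x hxK => ⟨fun hxr => ?_, fun hxr => ?_⟩⟩
  · -- off the regular set: `up α x = 0`
    rw [hUp, if_neg (fun h => hxr ((hreg x).2 h))]
  · have hxreg : IsRegularElt (x.val : GL (Fin 3) (UnitaryGroup.LocalRing L v)) := (hreg x).1 hxr
    -- the equivalence relation and its quotient
    have hEq : Equivalence (IsLocalStablyConjH L v) :=
      ⟨fun a => IsStablyConjH.refl _ _ _ a, fun h => h.symm, fun h h' => h.trans h'⟩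
    have hmk : ∀ a b, Quot.mk (IsLocalStablyConjH L v) a = Quot.mk (IsLocalStablyConjH L v) b ↔ IsLocalStablyConjH L v a b :=
      fun a b => Quot.eq.trans hEq.eqvGen_iff
    have hout : ∀ q : Quot (IsLocalStablyConjH L v), IsLocalStablyConjH L v q.out q.out := fun q => hEq.refl _
    have hout' : ∀ a, IsLocalStablyConjH L v (Quot.mk (IsLocalStablyConjH L v) a).out a :=
      fun a => (hmk _ _).1 (Quot.out_eq _)
    -- the norm fibre of `x`: at most three stable classes
    obtain ⟨S₀, hcard, hS₀, hpair, hexh⟩ := exists_finset_normFibre_card_le_three L (qsForm L) v hsub x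
    -- the summand
    set F : Quot (IsLocalStablyConjH L v) → ℂ := fun q =>
      if IsLocalGRegular L v q.out ∧ IsLocalNormPair L (qsForm L) v q.out x then
        finTau L v q.out μ * (𝔇.DH q.out : ℂ) * ((finKappaAt L v (qsForm L) q.out x : ℤ) : ℂ) * α q.out
      else 0 with hF
    have hsupp : Function.support F ⊆ ((S₀.image (Quot.mk (IsLocalStablyConjH L v)) : Finset _) : Set _) := by
      intro q hq
      rw [Function.mem_support] at hq
      by_cases hc : IsLocalGRegular L v q.out ∧ IsLocalNormPair L (qsForm L) v q.out x
      · obtain ⟨t, ht, hqt⟩ := hexh q.out hc.1 hc.2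
        rw [Finset.coe_image, Set.mem_image]
        exact ⟨t, by exact_mod_cast ht, ((hmk _ _).2 hqt.symm).trans (Quot.out_eq q)⟩
      · exact absurd (by rw [hF]; exact if_neg hc) hq
    have hsum : ∑ᶠ q, F q = ∑ q ∈ S₀.image (Quot.mk (IsLocalStablyConjH L v)), F q :=
      finsum_eq_finsetSum_of_support_subset F hsupp
    -- representatives in `C`
    have hrepS : ∀ t ∈ S₀, ∃ s' ∈ C, IsLocalGRegular L v s' ∧ IsLocalStablyConjH L v t s' :=
      fun t ht => hrep t (hS₀ t ht).1 ⟨x, hxK, (hS₀ t ht).2⟩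
    choose! sC hsCmem hsCreg hsCconj using hrepS
    have hinjC : Set.InjOn sC ↑S₀ := by
      intro t ht t' ht' he
      by_contra hne
      exact hpair t ht t' ht' hne ((hsCconj t ht).trans (by rw [he]; exact (hsCconj t' ht').symm))
    have hinjMk : Set.InjOn (Quot.mk (IsLocalStablyConjH L v)) ↑S₀ := by
      intro t ht t' ht' he
      by_contra hne
      exact hpair t ht t' ht' hne ((hmk _ _).1 he)
    refine ⟨S₀.image sC, Finset.card_image_le.trans hcard, ?_, ?_, ?_⟩
    · intro s hs
      obtain ⟨t, ht, rfl⟩ := Finset.mem_image.1 hs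
      exact hsCmem t ht
    · intro s hs
      obtain ⟨t, ht, rfl⟩ := Finset.mem_image.1 hs
      exact hsCreg t ht
    · -- the bound
      have hup : 𝔇.up α x = ((𝔇.DG x : ℂ))⁻¹ * ∑ q ∈ S₀.image (Quot.mk (IsLocalStablyConjH L v)), F q := by
        rw [hUp, if_pos hxreg, ← hsum]
      -- each summand is dominated by `‖D_H(sC t) α(sC t)‖`
      have hterm : ∀ t ∈ S₀, ‖F (Quot.mk _ t)‖ ≤ ‖(𝔇.DH (sC t) : ℂ) * α (sC t)‖ := by
        intro t ht
        simp only [hF]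
        split_ifs with hc
        · have h1 : IsLocalStablyConjH L v (Quot.mk (IsLocalStablyConjH L v) t).out (sC t) :=
            (hout' t).trans (hsCconj t ht)
          have hD : 𝔇.DH (sC t) = 𝔇.DH (Quot.mk (IsLocalStablyConjH L v) t).out := hDHst _ _ hc.1 h1
          have hA : α (sC t) = α (Quot.mk (IsLocalStablyConjH L v) t).out :=
            hα.2 _ (hRegH _ hc.1) _ ((hStH _ _).2 h1)
          rw [hD, hA, norm_mul, norm_mul, norm_mul, norm_mul]
          calc ‖finTau L v (Quot.mk (IsLocalStablyConjH L v) t).out μ‖ * ‖(𝔇.DH (Quot.mk (IsLocalStablyConjH L v) t).out : ℂ)‖ *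
                ‖((finKappaAt L v (qsForm L) (Quot.mk (IsLocalStablyConjH L v) t).out x : ℤ) : ℂ)‖ * ‖α (Quot.mk (IsLocalStablyConjH L v) t).out‖
              ≤ 1 * ‖(𝔇.DH (Quot.mk (IsLocalStablyConjH L v) t).out : ℂ)‖ * 1 * ‖α (Quot.mk (IsLocalStablyConjH L v) t).out‖ := by
                gcongr
                · exact norm_finTau_le_one L v μ hμ _
                · exact norm_finKappaAt_le_one L v (qsForm L) _ _
            _ = ‖(𝔇.DH (Quot.mk (IsLocalStablyConjH L v) t).out : ℂ)‖ * ‖α (Quot.mk (IsLocalStablyConjH L v) t).out‖ := by ring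
        · rw [norm_zero]
          exact norm_nonneg _
      rw [Finset.sum_image hinjC]
      by_cases hD0 : (𝔇.DG x : ℂ) = 0
      · rw [hD0, zero_mul, norm_zero]
        exact Finset.sum_nonneg fun t _ => norm_nonneg _
      · rw [hup, ← mul_assoc, mul_inv_cancel₀ hD0, one_mul, Finset.sum_image hinjMk]
        exact (norm_sum_le _ _).trans (Finset.sum_le_sum hterm)

end Summit.HodgeConjecture.HodgeConjecture.Cruxes.H413.F0P3cStCharTSUpDom

end
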